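import Literature.Topology.PlanarFoliations.ProngDirection
import Literature.Topology.PlanarFoliations.HyperbolicArc
import HarnessLib

/-!
# Turning at a saddle: the neighbour of an in-prong is an out-prong

Topic: Topology / PlanarFoliations, sequel to `ProngDirection.lean` (chart types ↔ tails) and
`HyperbolicArc.lean` (adjacent prongs have opposite chart types). **If the prong `jin` of a prong
star carries a forward tail of a line leaf (the leaf arrives at the puncture `v` along it), then
for every height `h ≠ 0` the prong of the neighbouring sector `nb jin h` is an out-prong of the
line leaf containing it**: `v` is in its α-limit set and the whole prong arc is a backward tail
(`alphaSet_and_bwdTail_nb_of_fwdTail`). This is the turning step of the walk along a separatrix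
graph hugged by compact leaves.

All statements are [folklore].
-/

noncomputable section

open Set Filter Function
open _root_.Topology
open Literature.Topology.FourManifolds Literature.Topology.FourManifolds.Foliation

namespace Literature.Topology.PlanarFoliations

namespace ProngStar

variable {X : Type*} [TopologicalSpace X] [T2Space X] [SecondCountableTopology X] [Nonempty X] {F : Foliation ℝ X}
  {ι : X → ℂ} {v : ℂ} {n : ℕ} (P : ProngStar F ι v n) (hbi : IsBiOriented F) (hι : IsOpenEmbedding ι)

omit [T2Space X] [SecondCountableTopology X] [Nonempty X] in
/-- The neighbour of a sector depends only on the sign of the height. [folklore] -/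
theorem nb_eq_nb_of_mul_pos {j : ZMod n} {h h' : ℝ} (hhh' : 0 < h * h') : P.nb j h = P.nb j h' := by
  have key : (0 ≤ P.sg j * h) ↔ (0 ≤ P.sg j * h') := by
    rcases P.sg_sq j with hs | hs <;> rw [hs]
    · simp only [one_mul]
      constructor <;> intro H <;> by_contra H' <;> push Not at H' <;> nlinarith
    · simp only [neg_one_mul, neg_nonneg]
      constructor <;> intro H <;> by_contra H' <;> push Not at H' <;> nlinarith
  unfold nb
  by_cases h1 : 0 ≤ P.sg j * h
  · rw [if_pos h1, if_pos (key.1 h1)]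
  · rw [if_neg h1, if_neg fun h2 ↦ h1 (key.2 h2)]

/-- The prong arc of a prong carrying a forward tail lies in the leaf of the tail. [folklore] -/
theorem horiz_mem_leaf_of_fwdTail {x : X} [NoncompactSpace (F.Leaf x)] (E : P.FwdTail hbi x) {b : ℝ} (hb : b ∈ Ioc 0 P.ρ) :
    P.horiz hι E.j 0 b ∈ F.leaf x := by
  have hr : ∀ {β}, β ∈ Ioc 0 P.ρ → ((β, (0 : ℝ)) : ℝ × ℝ) ∈ P.rect := fun hβ ↦ (P.mem_rect_iff).2 ⟨⟨hβ.1.le, hβ.2⟩, by simp [P.ρ_pos.le]⟩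
  have hne : ∀ {β}, β ∈ Ioc 0 P.ρ → ((β, (0 : ℝ)) : ℝ × ℝ) ≠ 0 := fun hβ h0 ↦ by
    have := congrArg Prod.fst h0; simp at this; linarith [hβ.1]
  -- the base point of the tail is a prong point
  have hp : P.horiz hι E.j 0 E.β₀ = Leaf.pt E.p := by
    apply hι.injective
    rw [P.ι_horiz hι (hr E.hβ₀) (hne E.hβ₀), E.hp]
  have hmem : P.horiz hι E.j 0 b ∈ F.leaf (P.horiz hι E.j 0 E.β₀) := P.horiz_mem_leaf' hι (hr E.hβ₀) (hr hb) (Or.inr ⟨E.hβ₀.1, hb.1⟩)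
  have hpx : Leaf.pt E.p ∈ F.leaf x := E.p.2
  rw [hp, Foliation.leaf_eq_of_mem hpx] at hmem
  exact hmem

/-- **The neighbour of an in-prong is an out-prong.** Let the prong `jin` carry a forward tail of
the line leaf of `x` (with `v` in its ω-limit set), let `h ≠ 0`, and let the prong arc of the
neighbour `nb jin h` lie in the line leaf of `y`. Then `v` is in the α-limit set of the leaf of
`y`, and the whole prong arc of `nb jin h` is a backward tail. [folklore] -/
theorem alphaSet_and_bwdTail_nb_of_fwdTail {x : X} [NoncompactSpace (F.Leaf x)] (E : P.FwdTail hbi x) (hω : v ∈ omegaSet hbi ι x)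
    {h : ℝ} (hh0 : h ≠ 0) {y : X} [NoncompactSpace (F.Leaf y)] (hy : ∀ b ∈ Ioc 0 P.ρ, P.horiz hι (P.nb E.j h) 0 b ∈ F.leaf y) :
    v ∈ alphaSet hbi ι y ∧ ∃ Eb : P.BwdTail hbi y, Eb.j = P.nb E.j h ∧ Eb.β₀ = P.ρ := by
  have hρ := P.ρ_pos
  have hx : ∀ b ∈ Ioc 0 P.ρ, P.horiz hι E.j 0 b ∈ F.leaf x := fun b hb ↦ horiz_mem_leaf_of_fwdTail P hbi hι E hb
  -- the box at the in-prong, around `b₀ = β₀ / 2`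
  set b₀ := E.β₀ / 2 with hb₀
  have hb₀pos : 0 < b₀ := by rw [hb₀]; linarith [E.hβ₀.1]
  have hb₀ρ : b₀ < P.ρ := by rw [hb₀]; linarith [E.hβ₀.1, E.hβ₀.2]
  obtain ⟨e, he, δ, hδ, hδb, hbδ, -, hsrc, hplq, htype⟩ := P.exists_box_uniform_type hι E.j hb₀pos hb₀ρ
  have h0I : (0 : ℝ) ∈ Ioo (-δ) δ := ⟨by linarith, hδ⟩
  -- its type is decreasing (forward tail)
  have hdecr : ∀ h' ∈ Ioo (-δ) δ, StrictAntiOn (fun β ↦ (e (P.horiz hι E.j h' β)).1) (Icc (b₀ - δ) (b₀ + δ)) := by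
    rcases htype with hinc | hdec'
    · exfalso
      set δ₁ := min δ (E.β₀ / 4) with hδ₁
      have hδ₁pos : 0 < δ₁ := lt_min hδ (by linarith [E.hβ₀.1])
      have hsub : Icc (b₀ - δ₁) (b₀ + δ₁) ⊆ Icc (b₀ - δ) (b₀ + δ) := Icc_subset_Icc (by linarith [min_le_left δ (E.β₀ / 4)]) (by linarith [min_le_left δ (E.β₀ / 4)])
      have hI : Icc (b₀ - δ₁) (b₀ + δ₁) ⊆ Ioc 0 E.β₀ := fun β hβ ↦
        ⟨by linarith [hβ.1, min_le_left δ (E.β₀ / 4)], by linarith [hβ.2, min_le_right δ (E.β₀ / 4), E.hβ₀.1]⟩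
      refine not_strictMonoOn_of_fwdTail (hbi := hbi) (hx := hx) E rfl hω he hδ₁pos hI (fun β hβ ↦ ⟨hsrc 0 h0I β (hsub hβ), hplq 0 h0I β (hsub hβ) b₀ ⟨by linarith, by linarith⟩⟩) ?_
      exact (hinc 0 h0I).mono hsub
    · exact hdec'
  -- the box at the out-prong `jout := nb jin h`, around `ρ / 2`
  set jout := P.nb E.j h with hjout
  obtain ⟨e', he', δ', hδ', hδb', hbδ', -, hsrc', hplq', htype'⟩ := P.exists_box_uniform_type hι jout (half_pos hρ) (half_lt_self hρ)
  have h0I' : (0 : ℝ) ∈ Ioo (-δ') δ' := ⟨by linarith, hδ'⟩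
  -- a small height `h'` of the sign of `h`
  set m := min δ δ' / 2 with hm
  have hmpos : 0 < m := by rw [hm]; exact half_pos (lt_min hδ hδ')
  have hmδ : m < δ := by rw [hm]; linarith [min_le_left δ δ']
  have hmδ' : m < δ' := by rw [hm]; linarith [min_le_right δ δ']
  set h' : ℝ := if 0 < h then m else -m with hh'
  have hhh' : 0 < h * h' := by
    rw [hh']; split_ifs with hpos
    · exact mul_pos hpos hmpos
    · have : h < 0 := lt_of_le_of_ne (not_lt.1 hpos) hh0
      nlinarith
  have hh'abs : |h'| = m := by rw [hh']; split_ifs <;> simp [abs_neg, abs_of_pos hmpos]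
  have hh'0 : h' ≠ 0 := fun h0 ↦ by rw [h0, mul_zero] at hhh'; exact lt_irrefl _ hhh'
  have hh'I : h' ∈ Ioo (-δ) δ := by rw [mem_Ioo, ← abs_lt, hh'abs]; exact hmδ
  have hh'I' : h' ∈ Ioo (-δ') δ' := by rw [mem_Ioo, ← abs_lt, hh'abs]; exact hmδ'
  have hh'ρ : h' ∈ Icc (-P.ρ) P.ρ := by
    have : m ≤ P.ρ := by linarith [hbδ, hδb]
    rw [mem_Icc, ← abs_le, hh'abs]; exact this
  have hnb : P.nb E.j h' = jout := (P.nb_eq_nb_of_mul_pos (by rwa [mul_comm] at hhh')).trans hjout.symm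
  -- the out-type is increasing: decreasing is excluded by the hyperbolic arc at the height `h'`
  have hincr : ∀ h'' ∈ Ioo (-δ') δ', StrictMonoOn (fun β ↦ (e' (P.horiz hι jout h'' β)).1) (Icc (P.ρ / 2 - δ') (P.ρ / 2 + δ')) := by
    rcases htype' with hinc' | hdec''
    · exact hinc'
    · exfalso
      have hI : Icc (b₀ - δ / 2) (b₀ + δ / 2) ⊆ Ioo 0 P.ρ := fun β hβ ↦ ⟨by linarith [hβ.1], by linarith [hβ.2]⟩
      have hI' : Icc (P.ρ / 2 - δ' / 2) (P.ρ / 2 + δ' / 2) ⊆ Ioo 0 P.ρ := fun β hβ ↦ ⟨by linarith [hβ.1], by linarith [hβ.2]⟩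
      have hsub : Icc (b₀ - δ / 2) (b₀ + δ / 2) ⊆ Icc (b₀ - δ) (b₀ + δ) := Icc_subset_Icc (by linarith) (by linarith)
      have hsub' : Icc (P.ρ / 2 - δ' / 2) (P.ρ / 2 + δ' / 2) ⊆ Icc (P.ρ / 2 - δ') (P.ρ / 2 + δ') := Icc_subset_Icc (by linarith) (by linarith)
      have key := not_strictAntiOn_nb_of_strictAntiOn (P := P) (hι := hι) hbi hh'ρ hh'0 he (half_pos hδ) hI
        (hsrc h' hh'I b₀ ⟨by linarith, by linarith⟩) ((hdecr h' hh'I).mono hsub) he' (half_pos hδ') hI'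
        (by rw [hnb]; exact hsrc' h' hh'I' _ ⟨by linarith, by linarith⟩)
      rw [hnb] at key
      exact key ((hdec'' h' hh'I').mono hsub')
  -- conclude with the direction lemmas at the height `0`
  have hI₀ : Icc (P.ρ / 2 - δ') (P.ρ / 2 + δ') ⊆ Ioc 0 P.ρ := fun β hβ ↦ ⟨by linarith [hβ.1], by linarith [hβ.2]⟩
  have hsrc₀ : ∀ β ∈ Icc (P.ρ / 2 - δ') (P.ρ / 2 + δ'), P.horiz hι jout 0 β ∈ e'.source ∧
      (e' (P.horiz hι jout 0 β)).2 = (e' (P.horiz hι jout 0 (P.ρ / 2))).2 := fun β hβ ↦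
    ⟨hsrc' 0 h0I' β hβ, hplq' 0 h0I' β hβ (P.ρ / 2) ⟨by linarith, by linarith⟩⟩
  exact ⟨mem_alphaSet_of_strictMonoOn (hbi := hbi) (hx := hy) he' hδ' hI₀ hsrc₀ (hincr 0 h0I'),
    nonempty_bwdTail_of_strictMonoOn (hbi := hbi) (hx := hy) he' hδ' hI₀ hsrc₀ (hincr 0 h0I')⟩

end ProngStar

end Literature.Topology.PlanarFoliations
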